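import Mathlib
import Summits.MatrixMultiplication.MatrixMultiplication.Theses.FourierTwoFamiliesModP

/-!
# Line `guard-band-entropy` — skeleton for the crux `PrimeCyclicPowerGain`
(stmt-MatrixMultiplication-14309, route `FourierTwoFamiliesModP`, rank 2) — gen 2 (reviewed and sharpened;
signatures of the three registered stubs are UNCHANGED from gen 1, docstrings and guidance corrected)

Crux (fixed, the route's decl): `∃ c > 0, s₀ : every balanced SDPP configuration (n pairs,
|A_i| = |B_i| = s ≥ s₀, (W), (X)) in ℤ/pℤ has n·s^(1+c) ≤ p`.

Idea card `Cruxes/PrimeCyclicPowerGain/Ideas/guard-band-entropy.md` (triage r1: pass ×3).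
Lever: move to the integers (free in this direction: `ZMod.val` lift), read everything in a fixed
base `M`, and charge the Hartley DEFICIT of the digit filtrations of the two ambient sets
`X = ⊔ A_i`, `Y = ⊔ B_i` JOINTLY and CUMULATIVELY FROM THE FINE SCALES against the digit ACTIVITY
of the blocks: if every block carries `μ` (resp. `ν`) base-`M` scales of bits strictly below scale
`t-1`, the product of the fullnesses of `X` and `Y` in their `M^t`-cells is `≤ C·M^(-c(μ+ν))`
(triage r1-1: the charge must be cumulative, not scale-by-scale; gen 2: it must be JOINT — each
one-sided half "`Y` pays for the `A`-bits" is FALSE, see `stub_scaleCharging`).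

Skeleton (3 registered stubs + kernel-checked composition):

* `stub_scaleCharging` — THE HEART (open; rank-2 content of the line): `∃ M ≥ 2, c > 0, C > 0,
  ScaleChargingWith M c C`, i.e. for every balanced SDPP configuration of naturals, every scale
  `t ≥ 1` and all `μ ν : ℕ` such that every `A_i` (resp. `B_i`) meets at most `s/M^μ` (resp. `s/M^ν`)
  cells of side `M^(t-1)`:  `(n s)² · M^(c(μ+ν)) ≤ C · M^(2t) · |π_t X| · |π_t Y|`.
  At `t = ⌈log_M N⌉` (one cell) this is the integer power gain; below that it is a LOCALISED crux:
  on copy-structured configurations (every block = far-apart copies of one component pair inside an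
  `M^t`-window) the inequality at scale `t` is exactly the integer power gain for the component
  family at block size `M^μ` (gen-2 note F2) — consistent, same exponent cap `c < 0.546`.
* `stub_digitBudget` — provable now (M): the heart ⇒ `IntegerPowerGainWith c C' (M^2)`:
  take `t = Nat.log M N + 1` (so `|π_t X| = |π_t Y| = 1`, `M^t ≤ M·N`) and
  `μ = ν = Nat.log M s - 1` (every block meets ≤ `M` top cells; `M^μ > s/M²`); rpow algebra.
* `stub_integerTransfer` — provable now (M): `IntegerPowerGainWith c C s₀ ⇒ CyclicPowerGainWith
  (c/2) s₁`: lift a `ZMod p` configuration by `ZMod.val` into `range p` (an equation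
  `a + b = a' + b'` among the lifts descends mod `p`, so (W),(X) are inherited for free — no window,
  no loss in `n` or `s`), apply the integer gain with `N = p`, absorb `C` into `s^(c/2)` for
  `s ≥ s₁ := max s₀ ⌈C^(2/c)⌉`.
* `PrimeCyclicPowerGain_of` — the composition, a real proof concluding the crux BY NAME.

Proved helpers in this file (sorry-free, not registered): `scaleChargingWith_of_avg` (the averaged
/ geometric-mean form `ScaleChargingAvgWith` implies the registered min form),
`primeCyclicPowerGain_iff` (the crux is `∃ c > 0, ∃ s₀, CyclicPowerGainWith c s₀`, by `Iff.rfl`),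
`card_le_pow_mul_card_cells` (`|S| ≤ M^t · |π_t S|`, the fibre bound every fullness argument uses).

Disproof used (cdisprove v1–v3 evidence notes; the Disproof.lean file itself is not mounted in
planner jails, checked again in gen 2): honours `false_without_W` (the heart uses (W): for a block
`j` and a shift `d ≠ 0` the label rule below excludes the label `j` only through directness),
`false_without_X` (the label rule IS clause (X): `(a'+d) + b = a' + (b+d)` with `a' ∈ A_j, b ∈ B_j`
forces the blocks of `a'+d` and `b+d` to coincide), `false_without_balanceB` (balanced `s`
throughout); consistent with `translate_wall` (translates are tight in the heart at every `t`, `c ≤ 1`),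
with `Digit.digit_design` / `not_powerGainAt_of_large` (any proof of the heart has `c < 0.546`: its
top-scale instance on the radix-9 design is the crux instance, and by F2 the same cap recurs at
every scale on copies of that design) and with `primeCyclicPowerGain_iff_cyclicPowerGain` /
`_iff_thresholdFree` (primality and `s₀` are not used by the line either). No landed `Negative/`
lemma exists yet for this crux (directory absent 2026-08-16), so no stub instance is refuted.
-/

namespace Summit.MatrixMultiplication.MatrixMultiplication.Cruxes.PrimeCyclicPowerGain.GuardBandEntropy

open Finset
open Summit.MatrixMultiplication.MatrixMultiplication.Theses.FourierTwoFamiliesModP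
  (PrimeCyclicPowerGain)

section Defs

variable {n : ℕ}

/-- Clause (W) for configurations of natural numbers (each pair `(A i, B i)` is direct:
`a + b = a' + b'` inside the pair forces `a = a'`, `b = b'`). This is the `ZMod`/`ℤ` clause
`(a - a') + (b - b') = 0 → …` written without subtraction. -/
def NatW (A B : Fin n → Finset ℕ) : Prop :=
  ∀ i : Fin n, ∀ a ∈ A i, ∀ a' ∈ A i, ∀ b ∈ B i, ∀ b' ∈ B i, a + b = a' + b' → a = a' ∧ b = b'

/-- Clause (X) (simultaneity) for configurations of natural numbers:
`a ∈ A i`, `a' ∈ A j`, `b ∈ B j`, `b' ∈ B k`, `a + b = a' + b'` force `i = k`. -/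
def NatX (A B : Fin n → Finset ℕ) : Prop :=
  ∀ i j k : Fin n, ∀ a ∈ A i, ∀ a' ∈ A j, ∀ b ∈ B j, ∀ b' ∈ B k, a + b = a' + b' → i = k

/-- The occupied base-`M` cells of side `M^t` of a finite set of naturals
(`π_t S = {⌊x / M^t⌋ : x ∈ S}`); `|π_0 S| = |S|`, and `log (|S| / |π_t S|)` is the cumulative
Hartley entropy ("bits") of `S` strictly below scale `t`. -/
def cells (M t : ℕ) (S : Finset ℕ) : Finset ℕ :=
  S.image (fun x => x / M ^ t)

/-- The union `X = ⋃ᵢ A i` of the blocks of a family. -/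
def blockUnion (A : Fin n → Finset ℕ) : Finset ℕ :=
  Finset.univ.biUnion A

end Defs

/-- **Scale charging** (the heart of the line, cumulative-from-below, Hartley form, one scale of
slack for carries). Base `M`, exponent `c`, constant `C`: for every balanced SDPP configuration of
naturals `(A i, B i)_{i<n}`, `|A i| = |B i| = s`, every scale `t ≥ 1` and all `μ ν : ℕ` with
`|π_{t-1}(A i)|·M^μ ≤ s` and `|π_{t-1}(B i)|·M^ν ≤ s` for every `i` (every block carries at least
`μ`, resp. `ν`, scales of Hartley bits strictly below scale `t-1`),
`(n·s)² · (M^(μ+ν))^c ≤ C · (M^t)² · |π_t X| · |π_t Y|`, `X = ⋃ A i`, `Y = ⋃ B i`: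
the joint Hartley deficit of the two ambient sets below scale `t` pays a fixed fraction `c` of the
blocks' digit activity below scale `t-1`. Translates of `([0,s), s·[0,s))` are tight (`c ≤ 1`);
the radix-`M₀` digit designs force `c < 0.546` at the top scale and are slacker below it. -/
def ScaleChargingWith (M : ℕ) (c C : ℝ) : Prop :=
  ∀ (n s t μ ν : ℕ) (A B : Fin n → Finset ℕ), 1 ≤ t →
    (∀ i, (A i).card = s ∧ (B i).card = s) → NatW A B → NatX A B →
    (∀ i, (cells M (t - 1) (A i)).card * M ^ μ ≤ s) →
    (∀ i, (cells M (t - 1) (B i)).card * M ^ ν ≤ s) →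
    ((n : ℝ) * (s : ℝ)) ^ 2 * ((M : ℝ) ^ (μ + ν)) ^ c
      ≤ C * ((M : ℝ) ^ t) ^ 2 * ((cells M t (blockUnion A)).card : ℝ)
          * ((cells M t (blockUnion B)).card : ℝ)

/-- **Scale charging, averaged form** (the natural inductive statement; STRONGER than
`ScaleChargingWith`, which it implies by `scaleChargingWith_of_avg`): the same conclusion under the
weaker hypothesis that the blocks carry `μ` (resp. `ν`) scales of Hartley bits below scale `t-1`
ON (geometric) AVERAGE, `∏ᵢ |π_{t-1}(A i)| · M^(nμ) ≤ s^n`. This is what an entropy / induction-on-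
`t` proof of the heart is expected to deliver; it is recorded here for the lead, not registered. -/
def ScaleChargingAvgWith (M : ℕ) (c C : ℝ) : Prop :=
  ∀ (n s t μ ν : ℕ) (A B : Fin n → Finset ℕ), 1 ≤ t →
    (∀ i, (A i).card = s ∧ (B i).card = s) → NatW A B → NatX A B →
    (∏ i, ((cells M (t - 1) (A i)).card : ℝ)) * (M : ℝ) ^ (n * μ) ≤ (s : ℝ) ^ n →
    (∏ i, ((cells M (t - 1) (B i)).card : ℝ)) * (M : ℝ) ^ (n * ν) ≤ (s : ℝ) ^ n →
    ((n : ℝ) * (s : ℝ)) ^ 2 * ((M : ℝ) ^ (μ + ν)) ^ c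
      ≤ C * ((M : ℝ) ^ t) ^ 2 * ((cells M t (blockUnion A)).card : ℝ)
          * ((cells M t (blockUnion B)).card : ℝ)

/-- The averaged form implies the registered (min) form: a uniform bound `|π_{t-1}(A i)|·M^μ ≤ s`
for every block gives the product bound (real proof). -/
theorem scaleChargingWith_of_avg {M : ℕ} {c C : ℝ} (h : ScaleChargingAvgWith M c C) :
    ScaleChargingWith M c C := by
  intro n s t μ ν A B ht hbal hW hX hA hB
  have prodBound : ∀ (E : Fin n → Finset ℕ) (κ : ℕ), (∀ i, (cells M (t - 1) (E i)).card * M ^ κ ≤ s) →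
      (∏ i, ((cells M (t - 1) (E i)).card : ℝ)) * (M : ℝ) ^ (n * κ) ≤ (s : ℝ) ^ n := by
    intro E κ hE
    have key : ∀ i : Fin n, ((cells M (t - 1) (E i)).card : ℝ) * (M : ℝ) ^ κ ≤ (s : ℝ) := by
      intro i; exact_mod_cast hE i
    calc (∏ i, ((cells M (t - 1) (E i)).card : ℝ)) * (M : ℝ) ^ (n * κ)
        = ∏ i : Fin n, (((cells M (t - 1) (E i)).card : ℝ) * (M : ℝ) ^ κ) := by
          rw [Finset.prod_mul_distrib, Finset.prod_const, Finset.card_univ, Fintype.card_fin,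
            ← pow_mul, mul_comm n κ]
      _ ≤ ∏ _i : Fin n, (s : ℝ) :=
          Finset.prod_le_prod (fun i _ => by positivity) (fun i _ => key i)
      _ = (s : ℝ) ^ n := by rw [Finset.prod_const, Finset.card_univ, Fintype.card_fin]
  exact h n s t μ ν A B ht hbal hW hX (prodBound A μ hA) (prodBound B ν hB)

/-- **Integer power gain** with explicit constants (the card's transfer target `C⁺`): balanced
SDPP configurations of naturals inside `[0, N)` with block size `s ≥ s₀` have
`n · s^(1+c) ≤ C · N`. Equivalent to the crux up to constants (val-lift / Bertrand). -/
def IntegerPowerGainWith (c C : ℝ) (s₀ : ℕ) : Prop :=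
  ∀ (N n s : ℕ) (A B : Fin n → Finset ℕ), s₀ ≤ s →
    (∀ i, A i ⊆ Finset.range N ∧ B i ⊆ Finset.range N) →
    (∀ i, (A i).card = s ∧ (B i).card = s) → NatW A B → NatX A B →
    (n : ℝ) * (s : ℝ) ^ (1 + c) ≤ C * (N : ℝ)

/-- The crux body with its two constants exposed: `CyclicPowerGainWith c s₀` is literally the
matrix of `PrimeCyclicPowerGain` at exponent `c` and threshold `s₀`
(`PrimeCyclicPowerGain ↔ ∃ c > 0, ∃ s₀, CyclicPowerGainWith c s₀` by `Iff.rfl`). -/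
def CyclicPowerGainWith (c : ℝ) (s₀ : ℕ) : Prop :=
  ∀ p : ℕ, p.Prime → ∀ (n s : ℕ) (A B : Fin n → Finset (ZMod p)), s₀ ≤ s →
    (∀ i : Fin n, (A i).card = s ∧ (B i).card = s) →
    (∀ i : Fin n, ∀ a ∈ A i, ∀ a' ∈ A i, ∀ b ∈ B i, ∀ b' ∈ B i,
      (a - a') + (b - b') = 0 → a = a' ∧ b = b') →
    (∀ i j k : Fin n, ∀ a ∈ A i, ∀ a' ∈ A j, ∀ b ∈ B j, ∀ b' ∈ B k,
      (a - a') + (b - b') = 0 → i = k) →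
    (n : ℝ) * (s : ℝ) ^ (1 + c) ≤ (p : ℝ)

/-- Sanity link (real proof): the crux is the existential closure of `CyclicPowerGainWith`. -/
theorem primeCyclicPowerGain_iff :
    PrimeCyclicPowerGain ↔ ∃ c : ℝ, 0 < c ∧ ∃ s₀ : ℕ, CyclicPowerGainWith c s₀ :=
  Iff.rfl

/-- Fibre bound (real proof): a finite set of naturals has at most `M^t` elements in each occupied
base-`M` cell of side `M^t`, so `|S| ≤ M^t · |π_t S|`; `log_M (M^t·|π_t S| / |S|) ≥ 0` is the
cumulative Hartley deficit of `S` below scale `t` that the heart charges. -/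
theorem card_le_pow_mul_card_cells (M t : ℕ) (hM : 0 < M) (S : Finset ℕ) :
    S.card ≤ M ^ t * (cells M t S).card := by
  unfold cells
  apply Finset.card_le_mul_card_image
  intro b _
  have hk : 0 < M ^ t := pow_pos hM t
  calc (S.filter (fun a => a / M ^ t = b)).card
      ≤ (Finset.Ico (b * M ^ t) (b * M ^ t + M ^ t)).card := by
        apply Finset.card_le_card
        intro a ha
        rw [Finset.mem_filter] at ha
        rw [Finset.mem_Ico]
        obtain ⟨_, rfl⟩ := ha
        exact ⟨Nat.div_mul_le_self a (M ^ t), Nat.lt_div_mul_add hk⟩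
    _ = M ^ t := by simp

/-! ## Registered stubs -/

/-- **stub 1 — THE HEART (rank-2 content; size XL; open).** Some base `M ≥ 2`, exponent `c > 0`
and constant `C > 0` satisfy JOINT scale charging. Guidance (gen 2, `Lines/guard-band-entropy.md`):
(a) do NOT split it into one-sided halves — "`n·s·(M^μ)^c ≤ C·M^t·|π_t Y|` under the `A`-hypothesis
alone" is FALSE for every `c > 0` (random `Y` of density `1/2` in an `M^t`-window admits, for most
`y`, a private `R_y ⊂ [0, M^(t-1))`, `|R_y| ≍ log M^t`, with `(y + (R_y - R_y) ∖ 0) ∩ Y = ∅` — clique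
number of random Cayley graphs, Green 2005 — and blocks `A_y` = far copies of `R_y`, `B_y` = far
copies of `{y}` form an SDPP configuration with `Y` half full at scale `t` and `μ → ∞`; there the
`X`-side pays, which is why the product form survives); (b) the mechanism is the LABEL RULE: for a
block `j` and a shift `d ≠ 0`, `a' + d ∈ A_i` (`a' ∈ A_j`) and `b + d ∈ B_k` (`b ∈ B_j`) force `i = k`
((X) verbatim) and `i = k = j` is excluded by (W); near-fullness of `X` around a rich cell of `A_j`
AND of `Y` around `B_j` labels most small shifts, Cauchy–Davenport bounds the label classes, and
representatives of distinct labels translate a rich component of `A_j` disjointly — the two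
near-fullnesses together are contradictory, one alone is not; (c) on copy-structured
configurations the statement at scale `t` is exactly the integer power gain for the component
family at block size `M^μ` (self-similarity), so expect no shortcut below the crux's difficulty —
the point of `∀ t` is cumulativity (an induction on scales with the averaged hypothesis
`ScaleChargingAvgWith`). Known designs: translates tight with `c = 1`; radix designs cap `c < 0.546`
(cdisprove `Digit.digit_design`); numerically the worst scale is always the top one (gen-1
heart_numerics.md). -/
theorem stub_scaleCharging :
    ∃ (M : ℕ) (c C : ℝ), 2 ≤ M ∧ 0 < c ∧ 0 < C ∧ ScaleChargingWith M c C := by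
  sorry

/-- **stub 2 — digit budget (provable now; size M).** Scale charging in base `M` with exponent
`c` gives the integer power gain with the SAME exponent: for a configuration inside `range N` take
`t := Nat.log M N + 1` (all of `range N` is one `M^t`-cell, so `|π_t X| = |π_t Y| = 1` when
`n·s > 0`, and `M^t ≤ M·N` by `Nat.pow_log_le_self`) and `μ = ν := Nat.log M s - 1` (each block
meets at most `M` cells of side `M^(t-1)` since it lies in `range (M^t)`, and
`M · M^μ = M^(Nat.log M s) ≤ s`; also `M^μ > s / M²` by `Nat.lt_pow_succ_log_self`); then
`(n s)² (s/M²)^(2c) ≤ C M² N²`, i.e. `n·s^(1+c) ≤ √C · M^(1+2c) · N`; threshold `s₀ = M²`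
(degenerate `n = 0` / `N = 0` cases are trivial). -/
theorem stub_digitBudget (M : ℕ) (c C : ℝ) (hM : 2 ≤ M) (hc : 0 < c) (hC : 0 < C)
    (h : ScaleChargingWith M c C) :
    ∃ (C' : ℝ) (s₀ : ℕ), 0 < C' ∧ IntegerPowerGainWith c C' s₀ := by
  sorry

/-- **stub 3 — integer transfer (provable now; size M).** The integer power gain with constants
`(c, C, s₀)` gives the crux body with exponent `c/2`: given a balanced SDPP configuration in
`ZMod p` (`p` prime, so `NeZero p`), lift every block by `ZMod.val` into `range p`
(`ZMod.val_injective` keeps the cards; an equation `a + b = a' + b'` in `ℕ` among lifts gives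
`((a:ZMod p) - a') + (b - b') = 0` after `ZMod.natCast_zmod_val`, so `NatW`/`NatX` follow from the
`ZMod` clauses), apply `IntegerPowerGainWith` with `N = p` to get `n·s^(1+c) ≤ C·p`, and for
`s ≥ s₁ := max s₀ (⌈C^(2/c)⌉₊ + 1)` conclude `n·s^(1+c/2) = n·s^(1+c)·s^(-c/2) ≤ C·p·s^(-c/2) ≤ p`
(`Real.rpow_natCast`, `Real.rpow_le_rpow_left_iff`, `Real.rpow_add`). -/
theorem stub_integerTransfer (c C : ℝ) (s₀ : ℕ) (hc : 0 < c) (hC : 0 < C)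
    (h : IntegerPowerGainWith c C s₀) : ∃ s₁ : ℕ, CyclicPowerGainWith (c / 2) s₁ := by
  sorry

/-! ## Composition (kernel-checked; concludes the crux BY NAME) -/

/-- The line closes the crux modulo its three stubs: heart ⇒ integer power gain (digit budget)
⇒ the crux with exponent `c/2` (integer transfer). -/
theorem PrimeCyclicPowerGain_of : PrimeCyclicPowerGain := by
  obtain ⟨M, c, C, hM, hc, hC, h⟩ := stub_scaleCharging
  obtain ⟨C', s₀, hC', h'⟩ := stub_digitBudget M c C hM hc hC h
  obtain ⟨s₁, h''⟩ := stub_integerTransfer c C' s₀ hc hC' h'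
  unfold PrimeCyclicPowerGain
  exact ⟨c / 2, half_pos hc, s₁, h''⟩

end Summit.MatrixMultiplication.MatrixMultiplication.Cruxes.PrimeCyclicPowerGain.GuardBandEntropy
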